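import Literature.IUT.HodgeArakelov.ThetaEvaluationSettingR
import Literature.IUT.HodgeArakelov.IotaInvariantThetaR
import Literature.IUT.HodgeArakelov.IotaInvariantThetaNegative
import Literature.AnabelianGeometry.EtaleTheta.TemperedCoverings

/-!
# [IUTchII] Prop 2.1, Prop 2.2 (i)′/(ii)′ — proofs (second proof-only companion of `ThetaEvaluationSetting*.lean`)

Proof-only companion (abc-iut cell, D-0067 wave 4, cone of [IUTchIII] Cor. 3.12; nodes **IUTchII:Prop2.1**,
**IUTchII:Prop2.2(i)**, **IUTchII:Prop2.2(ii)**; no definitions; audited modules imported unchanged). S. Mochizuki,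
*Inter-universal Teichmüller theory II*, kurims manuscript (Dec. 2020) §2, Prop. 2.1 pp. 64–65, Prop. 2.2 pp. 66–67
(claim key `Mochizuki2012`, DISPUTED, D-0012). Nothing here takes a side on [IUTchIII] Cor. 3.12; typed ≠ proved.
Every printed input used is an explicit binder of a theorem (no `def … : Prop`, no structure, no instance).

* **Prop. 2.1** (`TemperedCoverings`, OUTPUT structure tied to the reference diagram by `corresponds`):
  `TemperedCoverings.nonempty_iff` — the output EXISTS over `P` iff `P ≅ Π^tp_{X̲̲_v}` (transport of the reference
  data; the existence content for the GENUINE group is the owners' construction of `BadPlaceSetting`);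
  `TemperedCoverings.nonempty_comap` — FUNCTORIALITY along `P' ≃ₜ* P` (top row = preimage);
  `TemperedCoverings.YL_eq_of_characteristic` — WELL-DEFINEDNESS ("reconstructed from `Π_v`"): any two outputs over
  the same `P` have the same top row `Π^tp_{Ÿ̲_v} ⊆ Π^tp_{Y̲_v} ⊆ P`, PROVIDED the reference subgroups are characteristic
  in the topological group `Π^tp_{X̲̲_v}` (tree notion `Literature.AnabelianGeometry.EtaleTheta.IsTopCharacteristic`; the
  anabelian input of the printed proof, [EtTh] Prop. 2.4 — explicit hypothesis).
* **Prop. 2.2 (i)′** (`Prop22_i'`, repaired typing of record, `ThetaEvaluationSettingR.lean`): the EXISTENCE clause is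
  PROVED (`prop22_i'_of_stableRepresentative`) from the landed anabelian input `SubgraphReference.GroupTheoretic`
  plus the printed normalisation "we may assume that `Π_{v•}`, `Π_{v▶}`, and `ι := ι_Ÿ` … have been chosen so that some
  representative of `ι` stabilizes `Π_{v•}` and `Π_{v▶}`" (p. 66), taken as an explicit hypothesis in the shape the
  structure `SubgraphDecomposition` consumes; that hypothesis is the [IUTchI] Cor. 2.3 (iii) / [CombGC]
  decomposition-group input behind Rmk. 2.1.1 (ii) (whose graph half is PROVED in the typed file: `triGraph_map_neg`,
  `labelNeg_eq_self_iff`) — not derivable over the interface, reported to plan/GAP-LEDGER.md (D-0067), not asserted.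
* **Prop. 2.2 (ii)′** (`Prop22_ii'`, repaired typing of record, `IotaInvariantThetaR.lean`): PROVED
  (`prop22_ii'_of_translates`) from an explicit description of the `(l·ℤ × μ_2)`-orbit `η̈^{Θ,l·ℤ×μ_2}` and of the action
  of `ι` on it — the [EtTh] inputs quoted in the statement ([EtTh] Prop. 1.4 (ii); proof of Thm. 1.6 (iii)) in
  interface-level shape: the orbit consists of translates `τ n` of the standard class `τ 0` up to `2`-torsion classes
  (`μ_2` acts through the sign of `Θ̈`, so that `θ(Π_v)` is ONE `(l·ℤ)×μ_{2l}`-orbit as printed); `ι` carries `τ n` to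
  `τ(−n)` up to torsion (it reverses the `ℤ`-torsor of components, Rmk. 2.1.1 (i), and `Θ̈(−Ü) = −Θ̈(Ü)`); distinct
  translates differ by NON-torsion classes ([EtTh] Prop. 1.4 (i), divisor of poles); `ι` stabilises the orbit. Torsion
  bookkeeping `θ(Π_v)` ↔ orbit: `isOfFinAddOrder_iota_sub_iff_of_theta`; invariant translates have index `0`:
  `eq_zero_of_invariant_translate`; assembly via the landed constructor `IotaInvariantTheta'.nonempty_ofTorsionShift`.
-/

namespace Literature.IUT.HodgeArakelov

universe u

variable {S : BadPlaceSetting.{u}} {P : TopGroup.{u}}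

/-! ## Helpers (folklore) -/

section Helpers

/-- Membership in the image of a subgroup under a continuous multiplicative equivalence. [folklore] -/
private theorem mem_map_cme' {G' H' : TopGroup.{u}} {K : Subgroup G'} (e : G' ≃ₜ* H') {y : H'} :
    y ∈ K.map e.toMulEquiv.toMonoidHom ↔ e.symm y ∈ K :=
  Subgroup.mem_map_equiv

/-- Membership in the image of a subgroup under a conjugation automorphism. [folklore] -/
private theorem mem_map_conj' {G : Type u} [Group G] {K : Subgroup G} {g x : G} :
    x ∈ K.map (MulAut.conj g).toMonoidHom ↔ g⁻¹ * x * g ∈ K := by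
  rw [Subgroup.mem_map_equiv, MulAut.conj_symm_apply]

/-- Conjugation by `1` does not move a subgroup. [folklore] -/
private theorem map_conj_one {G : Type u} [Group G] (K : Subgroup G) :
    K.map (MulAut.conj (1 : G)).toMonoidHom = K := by
  ext x
  rw [mem_map_conj', inv_one, one_mul, mul_one]

/-- Pulling a subgroup back along `e` and pushing it forward along `e` gives it back. [folklore] -/
private theorem map_map_symm {G' H' : TopGroup.{u}} (K : Subgroup H') (e : G' ≃ₜ* H') :
    (K.map e.symm.toMulEquiv.toMonoidHom).map e.toMulEquiv.toMonoidHom = K := by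
  ext z
  rw [mem_map_cme', mem_map_cme', ContinuousMulEquiv.symm_symm, ContinuousMulEquiv.apply_symm_apply]

/-- In an additive commutative group, an element killed by a positive natural number has finite additive
order. [folklore] -/
private theorem isOfFinAddOrder_of_nsmul_eq_zero' {A : Type u} [AddCommGroup A] {n : ℕ} (hn : 0 < n)
    {a : A} (h : n • a = 0) : IsOfFinAddOrder a :=
  isOfFinAddOrder_iff_nsmul_eq_zero.mpr ⟨n, hn, h⟩

/-- An additive automorphism moves an element killed by `n` by an element killed by `n`. [folklore] -/
private theorem nsmul_map_sub_eq_zero {A : Type u} [AddCommGroup A] (ρ : A ≃+ A) {n : ℕ} {a : A}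
    (h : n • a = 0) : n • (ρ a - a) = 0 := by
  rw [smul_sub, ← map_nsmul, h, map_zero, sub_zero]

end Helpers

/-! ## Proposition 2.1: existence over isomorphs, functoriality, well-definedness -/

section Prop21

/-- **IUTchII:Prop2.1**, existence at the interface level (kurims pp. 64–65; as typed, `TemperedCoverings S P`
presupposes `P ≅ Π^tp_{X̲̲_v}` via `isoRef`): the Prop. 2.1 output EXISTS over `P` iff `P` is isomorphic to the
reference tempered fundamental group — forward: the field `isoRef`; converse: transport of the reference diagram of
`BadPlaceSetting` (bottom row = the reference bottom row, vertical arrow = `Π^tp_{X̲̲_v} ↪ Π^tp_{X_v}` precomposed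
with the isomorphism). [claim: Mochizuki2012, status: disputed] (IUTchII §2 Prop 2.1, kurims pp.64-65) -/
theorem TemperedCoverings.nonempty_iff :
    Nonempty (TemperedCoverings S P) ↔ Nonempty (P ≃ₜ* S.PiX) := by
  constructor
  · rintro ⟨T⟩
    exact T.isoRef
  · rintro ⟨e⟩
    refine ⟨{ isoRef := ⟨e⟩
              Xplain := S.PiXplain
              incl := S.inclPlain.comp e.toMulEquiv.toMonoidHom
              incl_isOpenEmbedding :=
                S.inclPlain_isOpenEmbedding.comp e.toHomeomorph.isOpenEmbedding
              Y := S.refY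
              Ydd := S.refYdd
              Ydd_le := S.refYdd_le
              isOpen_Y := S.isOpen_refY
              isOpen_Ydd := S.isOpen_refYdd
              corresponds := ⟨e, ContinuousMulEquiv.refl _, fun _ => rfl, ?_, ?_⟩ }⟩
    · change S.refY.map (MonoidHom.id _) = S.refY
      exact Subgroup.map_id _
    · change S.refYdd.map (MonoidHom.id _) = S.refYdd
      exact Subgroup.map_id _

/-- **IUTchII:Prop2.1**, FUNCTORIALITY (kurims p. 65, "functorial group-theoretic algorithm"): the output
transports along any isomorphism of topological groups `φ : P' ≅ P`; the transported top row
`Π^tp_{Ÿ̲_v} ⊆ Π^tp_{Y̲_v} ⊆ P'` is the preimage of the original one. [claim: Mochizuki2012, status: disputed]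
(IUTchII §2 Prop 2.1, kurims p.65) -/
theorem TemperedCoverings.nonempty_comap {P' : TopGroup.{u}} (T : TemperedCoverings S P) (φ : P' ≃ₜ* P) :
    ∃ T' : TemperedCoverings S P',
      T'.YL = T.YL.comap φ.toMulEquiv.toMonoidHom ∧ T'.YddL = T.YddL.comap φ.toMulEquiv.toMonoidHom := by
  obtain ⟨e, e', hcomm, hY, hYdd⟩ := T.corresponds
  refine ⟨{ isoRef := ⟨φ.trans e⟩
            Xplain := T.Xplain
            incl := T.incl.comp φ.toMulEquiv.toMonoidHom
            incl_isOpenEmbedding := T.incl_isOpenEmbedding.comp φ.toHomeomorph.isOpenEmbedding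
            Y := T.Y
            Ydd := T.Ydd
            Ydd_le := T.Ydd_le
            isOpen_Y := T.isOpen_Y
            isOpen_Ydd := T.isOpen_Ydd
            corresponds := ⟨φ.trans e, e', fun x => hcomm (φ x), hY, hYdd⟩ }, ?_, ?_⟩
  · exact (Subgroup.comap_comap T.Y T.incl φ.toMulEquiv.toMonoidHom).symm
  · exact (Subgroup.comap_comap T.Ydd T.incl φ.toMulEquiv.toMonoidHom).symm

/-- **IUTchII:Prop2.1**: along the identification `e : P ≅ Π^tp_{X̲̲_v}` provided by `corresponds`, the top
row of the output is read off in the reference group: `x ∈ Π^tp_{Y̲_v}(P) ↔ e x ∈ Π^tp_{Y_v} ∩ Π^tp_{X̲̲_v}`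
and likewise for `Ÿ̲`. [claim: Mochizuki2012, status: disputed] (IUTchII §2 Prop 2.1, kurims p.65) -/
theorem TemperedCoverings.exists_mem_iff (T : TemperedCoverings S P) :
    ∃ e : P ≃ₜ* S.PiX, (∀ x : P, x ∈ T.YL ↔ S.inclPlain (e x) ∈ S.refY) ∧
      ∀ x : P, x ∈ T.YddL ↔ S.inclPlain (e x) ∈ S.refYdd := by
  obtain ⟨e, e', hcomm, hY, hYdd⟩ := T.corresponds
  refine ⟨e, fun x => ?_, fun x => ?_⟩
  · rw [Subgroup.mem_comap, ← hcomm, ← hY, mem_map_cme', ContinuousMulEquiv.symm_apply_apply]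
  · rw [Subgroup.mem_comap, ← hcomm, ← hYdd, mem_map_cme', ContinuousMulEquiv.symm_apply_apply]

/-- **IUTchII:Prop2.1**, WELL-DEFINEDNESS ("may be reconstructed … from the [temp-slim!] topological group
`Π^tp_{X̲̲_v}`", p. 65): IF the reference subgroups `Π^tp_{Y̲_v} = Π^tp_{Y_v} ∩ Π^tp_{X̲̲_v}` and
`Π^tp_{Ÿ̲_v} = Π^tp_{Ÿ_v} ∩ Π^tp_{X̲̲_v}` are stable under every automorphism of the topological group
`Π^tp_{X̲̲_v}` — the tree's `Literature.AnabelianGeometry.EtaleTheta.IsTopCharacteristic` ([EtTh] Def. 3.3), the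
anabelian input of the printed proof ([EtTh] Prop. 2.4), an explicit hypothesis here — THEN any two Prop. 2.1 outputs
over the same `P` have the same top row `Π^tp_{Ÿ̲_v} ⊆ Π^tp_{Y̲_v} ⊆ P` (independence of the chosen identification
with the reference). [claim: Mochizuki2012, status: disputed] (IUTchII §2 Prop 2.1, kurims p.65) -/
theorem TemperedCoverings.YL_eq_of_characteristic
    (hY : Literature.AnabelianGeometry.EtaleTheta.IsTopCharacteristic S.PiX (S.refY.comap S.inclPlain))
    (hYdd : Literature.AnabelianGeometry.EtaleTheta.IsTopCharacteristic S.PiX (S.refYdd.comap S.inclPlain))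
    (T₁ T₂ : TemperedCoverings S P) : T₁.YL = T₂.YL ∧ T₁.YddL = T₂.YddL := by
  obtain ⟨e₁, h₁, h₁'⟩ := T₁.exists_mem_iff
  obtain ⟨e₂, h₂, h₂'⟩ := T₂.exists_mem_iff
  -- the automorphism `e₁ ∘ e₂⁻¹` of `Π^tp_{X̲̲_v}` carries `e₂ x` to `e₁ x`
  have key : ∀ (K : Subgroup S.PiXplain), Literature.AnabelianGeometry.EtaleTheta.IsTopCharacteristic S.PiX (K.comap S.inclPlain) →
      ∀ x : P, S.inclPlain (e₁ x) ∈ K ↔ S.inclPlain (e₂ x) ∈ K := by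
    intro K hK x
    have h := Subgroup.ext_iff.mp (hK (e₂.symm.trans e₁)) (e₁ x)
    rw [mem_map_cme', Subgroup.mem_comap, Subgroup.mem_comap, ContinuousMulEquiv.symm_trans_apply,
      ContinuousMulEquiv.symm_symm, ContinuousMulEquiv.symm_apply_apply] at h
    exact h.symm
  refine ⟨Subgroup.ext fun x => ?_, Subgroup.ext fun x => ?_⟩
  · rw [h₁, h₂, key S.refY hY x]
  · rw [h₁', h₂', key S.refYdd hYdd x]

end Prop21

/-! ## Proposition 2.2 (i)′: the existence clause -/

section Prop22i

variable {E : EnvOfGroup S.toThetaSetting P}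

/-- **IUTchII:Prop2.2(i)′**, EXISTENCE CLAUSE PROVED modulo the printed normalisation (kurims p. 66: "we may
assume that `Π_{v•}`, `Π_{v▶}`, and `ι := ι_Ÿ` [cf. Remarks 1.4.1, (ii); 2.1.1, (ii)] have been chosen so that some
representative of `ι` stabilizes `Π_{v•}` and `Π_{v▶}`"). Hypothesis `hstab` is that sentence in the shape
`SubgraphDecomposition` consumes: along any identification `e : Π_v ≅ Π^tp_{X̲̲_v}` compatible with the Prop. 2.1
output `T`, some `Δ`-conjugate `x ↦ δ·ι₀(x)·δ⁻¹` of the pointed inversion `ι₀` (Rmk. 1.4.1 (ii)) maps ONTO themselves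
the pulled-back decomposition groups `e⁻¹(Π^tp_{X,Γ▶})`, `e⁻¹(Π^tp_{X,Γ•})` and `Π_Ÿ(Π_v)` — the [IUTchI] Cor. 2.3 (iii)
/ [CombGC] decomposition-group input behind Rmk. 2.1.1 (ii) (graph half PROVED: `triGraph_map_neg`,
`labelNeg_eq_self_iff`); NOT derivable over the interface (plan/GAP-LEDGER.md). With it and the landed anabelian input
`SubgraphReference.GroupTheoretic` (well-definedness, `conj_of_liesOver`) the repaired `Prop22_i' R T D ι₀` HOLDS.
[claim: Mochizuki2012, status: disputed] (IUTchII §2 Prop 2.2 (i), kurims pp.66-67) -/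
theorem prop22_i'_of_stableRepresentative (R : SubgraphReference S) (T : TemperedCoverings S P)
    (D : EtaleThetaData S.toThetaSetting P) (ι₀ : PointedInversion E D) (hG : R.GroupTheoretic)
    (hstab : ∀ e : P ≃ₜ* S.PiX,
      (∃ e' : T.Xplain ≃ₜ* S.PiXplain, (∀ x, e' (T.incl x) = S.inclPlain (e x)) ∧
        T.Y.map e'.toMulEquiv.toMonoidHom = S.refY ∧ T.Ydd.map e'.toMulEquiv.toMonoidHom = S.refYdd) →
      ∃ δ : P, E.recon.projG (E.isoX δ) = 1 ∧
        (∀ x : P, e x ∈ R.refTri → e (δ * ι₀.iota x * δ⁻¹) ∈ R.refTri) ∧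
        (∀ x : P, e x ∈ R.refTri → ∃ y : P, e y ∈ R.refTri ∧ δ * ι₀.iota y * δ⁻¹ = x) ∧
        (∀ x : P, e x ∈ R.refBullet → e (δ * ι₀.iota x * δ⁻¹) ∈ R.refBullet) ∧
        (∀ x : P, e x ∈ R.refBullet → ∃ y : P, e y ∈ R.refBullet ∧ δ * ι₀.iota y * δ⁻¹ = x) ∧
        (∀ x : P, x ∈ D.PiYdd → δ * ι₀.iota x * δ⁻¹ ∈ D.PiYdd) ∧
        (∀ x : P, x ∈ D.PiYdd → ∃ y : P, y ∈ D.PiYdd ∧ δ * ι₀.iota y * δ⁻¹ = x)) :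
    Prop22_i' R T D ι₀ := by
  rw [prop22_i'_iff_exists_of_groupTheoretic hG]
  obtain ⟨e, e', hcomm, hY, hYdd⟩ := T.corresponds
  obtain ⟨δ, hδ, htri, htri', hbul, hbul', hydd, hydd'⟩ := hstab e ⟨e', hcomm, hY, hYdd⟩
  -- membership in the pulled-back reference pair
  have memTri : ∀ x : P, x ∈ R.refTri.map e.symm.toMulEquiv.toMonoidHom ↔ e x ∈ R.refTri := fun x => by
    rw [mem_map_cme', ContinuousMulEquiv.symm_symm]
  have memBul : ∀ x : P, x ∈ R.refBullet.map e.symm.toMulEquiv.toMonoidHom ↔ e x ∈ R.refBullet :=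
    fun x => by rw [mem_map_cme', ContinuousMulEquiv.symm_symm]
  -- the representative `κ = δ·ι₀(·)·δ⁻¹` as an isomorphism of topological groups
  let κ : P ≃ₜ* P :=
    { ι₀.iota.toMulEquiv.trans (MulAut.conj δ) with
      continuous_toFun := by
        show Continuous fun x => δ * ι₀.iota x * δ⁻¹
        exact (continuous_const.mul (map_continuous ι₀.iota)).mul continuous_const
      continuous_invFun := by
        show Continuous fun x => ι₀.iota.symm (δ⁻¹ * x * δ)
        exact (map_continuous ι₀.iota.symm).comp
          ((continuous_const.mul continuous_id).mul continuous_const) }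
  have hκ : ∀ x : P, κ x = δ * ι₀.iota x * δ⁻¹ := fun x => rfl
  have memκ : ∀ (K : Subgroup P) (x : P), x ∈ K.map κ.toMulEquiv.toMonoidHom ↔ ∃ y ∈ K, κ y = x :=
    fun K x => Subgroup.mem_map
  -- a subgroup mapped into itself and onto itself by `κ` is carried onto itself
  have stab : ∀ K : Subgroup P, (∀ y ∈ K, κ y ∈ K) → (∀ x ∈ K, ∃ y ∈ K, κ y = x) →
      K.map κ.toMulEquiv.toMonoidHom = K := by
    intro K h₁ h₂
    ext x
    rw [Subgroup.mem_map]
    constructor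
    · rintro ⟨y, hy, rfl⟩
      exact h₁ y hy
    · intro hx
      obtain ⟨y, hy, hyx⟩ := h₂ x hx
      exact ⟨y, hy, hyx⟩
  -- `Π_{v▶} ⊆ Π^tp_{Y̲_v}` along the Prop. 2.1 identification
  have tri_le : R.refTri.map e.symm.toMulEquiv.toMonoidHom ≤ T.YL := by
    intro x hx
    rw [memTri] at hx
    have h1 : S.inclPlain (e x) ∈ S.refY := R.refTri_le_Y hx
    rw [← hY] at h1
    obtain ⟨z, hz, hz'⟩ := h1
    rw [Subgroup.mem_comap]
    have : z = T.incl x := e'.injective (by rw [hcomm]; exact hz')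
    exact this ▸ hz
  have corrTri : (R.refTri.map e.symm.toMulEquiv.toMonoidHom).map e.toMulEquiv.toMonoidHom =
      R.refTri.map (MulAut.conj (1 : S.PiX)).toMonoidHom := by rw [map_map_symm, map_conj_one]
  have corrBul : (R.refBullet.map e.symm.toMulEquiv.toMonoidHom).map e.toMulEquiv.toMonoidHom =
      R.refBullet.map (MulAut.conj (1 : S.PiX)).toMonoidHom := by rw [map_map_symm, map_conj_one]
  refine ⟨{ Pbullet := R.refBullet.map e.symm.toMulEquiv.toMonoidHom
            Ptri := R.refTri.map e.symm.toMulEquiv.toMonoidHom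
            bullet_le_tri := Subgroup.map_mono R.refBullet_le
            tri_le_YL := tri_le
            iota := κ
            iota_bullet := stab _
              (fun y hy => (memBul _).mpr (by rw [hκ]; exact hbul y ((memBul y).mp hy)))
              (fun x hx => by
                obtain ⟨y, hy, hyx⟩ := hbul' x ((memBul x).mp hx)
                exact ⟨y, (memBul y).mpr hy, by rw [hκ]; exact hyx⟩)
            iota_tri := stab _
              (fun y hy => (memTri _).mpr (by rw [hκ]; exact htri y ((memTri y).mp hy)))
              (fun x hx => by
                obtain ⟨y, hy, hyx⟩ := htri' x ((memTri x).mp hx)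
                exact ⟨y, (memTri y).mpr hy, by rw [hκ]; exact hyx⟩)
            iota_Ydd := stab _ (fun y hy => by rw [hκ]; exact hydd y hy)
              (fun x hx => by
                obtain ⟨y, hy, hyx⟩ := hydd' x hx
                exact ⟨y, hy, by rw [hκ]; exact hyx⟩)
            refTri := R.refTri
            refBullet := R.refBullet
            corresponds := ⟨e, 1, corrTri, corrBul⟩ }, rfl, rfl, ⟨e, 1, corrTri, corrBul⟩,
    ⟨δ, hδ, fun x => hκ x⟩⟩

end Prop22i

/-! ## Proposition 2.2 (ii)′: the `ι`-invariant `μ_{2l}`-orbit -/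

section Prop22ii

/-- `ι` — any additive automorphism stabilising the orbit `η̈^{Θ,l·ℤ×μ_2}` — stabilises `θ(Π_v)`, because
`θ(Π_v)` is DEFINED from the orbit (`EtaleThetaData.theta_eq`: the `μ_l`-multiples of reciprocals of orbit
members) and an additive automorphism preserves `l`-torsion. [claim: Mochizuki2012, status: disputed]
(IUTchII §2 Prop 2.2 (ii), kurims p.66) -/
theorem EtaleThetaData.image_theta_eq_of_image_orbit_eq (D : EtaleThetaData S.toThetaSetting P)
    (ρ : D.coh.H1 ⊤ ≃+ D.coh.H1 ⊤) (horbit : ρ '' D.orbit = D.orbit) : ρ '' D.theta = D.theta := by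
  have fwd : ∀ σ : D.coh.H1 ⊤ ≃+ D.coh.H1 ⊤, σ '' D.orbit ⊆ D.orbit → σ '' D.theta ⊆ D.theta := by
    intro σ hσ
    rintro _ ⟨b, hb, rfl⟩
    rw [D.theta_eq] at hb ⊢
    obtain ⟨o, ho, hlo⟩ := hb
    refine ⟨σ o, hσ ⟨o, ho, rfl⟩, ?_⟩
    rw [← map_add, ← map_nsmul, hlo, map_zero]
  refine Set.Subset.antisymm (fwd ρ horbit.subset) ?_
  -- `ρ⁻¹` also stabilises the orbit, so `θ ⊆ ρ(θ)`
  have hinv : ρ.symm '' D.orbit ⊆ D.orbit := by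
    rintro _ ⟨o, ho, rfl⟩
    obtain ⟨o', ho', rfl⟩ : o ∈ ρ '' D.orbit := horbit.symm ▸ ho
    exact (AddEquiv.symm_apply_apply ρ o').symm ▸ ho'
  exact fun b hb => ⟨ρ.symm b, fwd ρ.symm hinv ⟨b, hb, rfl⟩, AddEquiv.apply_symm_apply ρ b⟩

/-- TORSION BOOKKEEPING between `θ(Π_v)` and the orbit: if `t` is attached to the orbit member `o` by
`l·(t + o) = 0` (`theta_eq`, `0 < l`), then `t` is moved by the additive automorphism `ρ` by a torsion
element iff `o` is — since `(ρ t − t) + (ρ o − o) = ρ(t+o) − (t+o)` is `l`-torsion (the step of [IUTchII]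
Prop. 2.2 (ii) passing from the orbit `η̈^{Θ,l·ℤ×μ_2}` to `θ(Π_v)`). [claim: Mochizuki2012, status: disputed]
(IUTchII §2 Prop 2.2 (ii), kurims p.66) -/
theorem isOfFinAddOrder_iota_sub_iff_of_theta {A : Type u} [AddCommGroup A] (ρ : A ≃+ A) {l : ℕ}
    (hl : 0 < l) {t o : A} (hto : l • (t + o) = 0) :
    IsOfFinAddOrder (ρ t - t) ↔ IsOfFinAddOrder (ρ o - o) := by
  have hz : IsOfFinAddOrder (ρ (t + o) - (t + o)) :=
    isOfFinAddOrder_of_nsmul_eq_zero' hl (nsmul_map_sub_eq_zero ρ hto)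
  have hsplit : ρ (t + o) - (t + o) = (ρ t - t) + (ρ o - o) := by rw [map_add]; abel
  rw [hsplit] at hz
  refine ⟨fun ht => ?_, fun ho => ?_⟩
  · simpa only [neg_add_cancel_left] using ht.neg.add hz
  · simpa only [add_neg_cancel_right] using hz.add ho.neg

/-- THE `ι`-INVARIANT TRANSLATES (the mechanism of the proof of [EtTh] Thm. 1.6 (iii) quoted in [IUTchII]
Prop. 2.2 (ii), at the level of an additive group `A` with an automorphism `ρ`): if `ρ` carries the translate
`τ n` to `τ(−n)` up to torsion and distinct translates differ by non-torsion elements, then a translate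
`τ n + c` (`2·c = 0`) moved by `ρ` by a torsion element has `n = 0` ("the vertex labeled `0` is fixed by
`ι_X`", Rmk. 2.1.1 (ii)). [claim: Mochizuki2012, status: disputed] (IUTchII §2 Prop 2.2 (ii), kurims p.66) -/
theorem eq_zero_of_invariant_translate {A : Type u} [AddCommGroup A] (ρ : A ≃+ A) (τ : ℤ → A)
    (hrev : ∀ n : ℤ, IsOfFinAddOrder (ρ (τ n) - τ (-n)))
    (hfree : ∀ m n : ℤ, IsOfFinAddOrder (τ m - τ n) → m = n)
    {n : ℤ} {c : A} (hc : 2 • c = 0) (hinv : IsOfFinAddOrder (ρ (τ n + c) - (τ n + c))) :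
    n = 0 := by
  -- `ρ(τ n + c) − (τ n + c) = ((ρ(τ n) − τ(−n)) + (ρ c − c)) + (τ(−n) − τ n)`
  have hc' : IsOfFinAddOrder (ρ c - c) :=
    isOfFinAddOrder_of_nsmul_eq_zero' two_pos (nsmul_map_sub_eq_zero ρ hc)
  have hsplit : ρ (τ n + c) - (τ n + c) = ((ρ (τ n) - τ (-n)) + (ρ c - c)) + (τ (-n) - τ n) := by
    rw [map_add]; abel
  rw [hsplit] at hinv
  have h := ((hrev n).add hc').neg.add hinv
  rw [neg_add_cancel_left] at h
  have := hfree (-n) n h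
  omega

variable {T : TemperedCoverings S P} {D : EtaleThetaData S.toThetaSetting P}

/-- **IUTchII:Prop2.2(ii)′** PROVED from the [EtTh]-shaped description of the orbit and of `ι` (kurims p. 66: "the
functorial group-theoretic algorithms `Π_v ↦ θ(Π_v) ⊆ ∞θ(Π_v) ⊆ …` of Proposition 1.4, together with the condition of
invariance with respect to `ι` [cf. [EtTh], Proposition 1.4, (ii); the proof of [EtTh], Theorem 1.6, (iii)],
determines a specific `μ_{2l}`-orbit `θ^ι(Π_v) ⊆ θ(Π_v)` within the unique `{(l·ℤ)×μ_{2l}}`-orbit contained in the set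
`θ(Π_v)`"). Inputs, all explicit: the `ι`-actions `ρ`, `ρlim` (compatible); `ι` stabilises the orbit (functoriality
of the Prop. 1.4 algorithm); the orbit = translates `τ n` of the standard class `τ 0 ∈ orbit` up to `2`-torsion classes
(deck translations × the sign of `Θ̈`); `ι` carries `τ n` to `τ(−n)` up to torsion ([EtTh] Prop. 1.4 (ii); `ι`
reverses the `ℤ`-torsor of components, Rmk. 2.1.1 (i)(ii)); distinct translates differ by non-torsion classes ([EtTh]
Prop. 1.4 (i)). CONCLUSION: `IotaInvariantTheta'` is instantiated with `ι`-action `ρ` — `θ^ι(Π_v)` is nonempty (it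
contains `−τ 0`) and is ONE `μ_{2l}`-orbit — i.e. `Prop22_ii' Dec` HOLDS.
[claim: Mochizuki2012, status: disputed] (IUTchII §2 Prop 2.2 (ii), kurims pp.66-67) -/
theorem prop22_ii'_of_translates (Dec : SubgraphDecomposition S T D)
    (ρ : D.coh.H1 ⊤ ≃+ D.coh.H1 ⊤) (ρlim : D.coh.lim ≃+ D.coh.lim)
    (hcompat : ∀ x, D.coh.toLim ⊤ (ρ x) = ρlim (D.coh.toLim ⊤ x))
    (horbit : ρ '' D.orbit = D.orbit)
    (τ : ℤ → D.coh.H1 ⊤) (hτ0 : τ 0 ∈ D.orbit)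
    (hdesc : ∀ o ∈ D.orbit, ∃ (n : ℤ) (c : D.coh.H1 ⊤), 2 • c = 0 ∧ o = τ n + c)
    (hrev : ∀ n : ℤ, IsOfFinAddOrder (ρ (τ n) - τ (-n)))
    (hfree : ∀ m n : ℤ, IsOfFinAddOrder (τ m - τ n) → m = n) :
    Prop22_ii' Dec := by
  have hl : 0 < (S.l : ℕ) := S.l_prime.pos
  -- the standard class is invariant up to torsion (`n = 0` in `hrev`)
  have hstd : IsOfFinAddOrder (ρ (τ 0) - τ 0) := by simpa using hrev 0
  -- every invariant orbit member is `τ 0 + c` with `2·c = 0`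
  have hmem : ∀ o ∈ D.orbit, IsOfFinAddOrder (ρ o - o) → ∃ c, 2 • c = 0 ∧ o = τ 0 + c := by
    intro o ho hinv
    obtain ⟨n, c, hc, rfl⟩ := hdesc o ho
    have hn : n = 0 := eq_zero_of_invariant_translate ρ τ hrev hfree hc hinv
    subst hn
    exact ⟨c, hc, rfl⟩
  show Nonempty (IotaInvariantTheta' Dec)
  refine IotaInvariantTheta'.nonempty_ofTorsionShift (Dec := Dec) ρ ρlim hcompat
    (D.image_theta_eq_of_image_orbit_eq ρ horbit) (-τ 0) (D.neg_mem_theta hτ0) ?_ ?_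
  · -- `ρ(−τ 0) − (−τ 0) = −(ρ(τ 0) − τ 0)` has finite order
    have h : ρ (-τ 0) - -τ 0 = -(ρ (τ 0) - τ 0) := by rw [map_neg]; abel
    rw [h]
    exact hstd.neg
  · -- the `μ_{2l}`-orbit clause
    intro t ht t' ht' hinv hinv'
    have ht₀ := ht
    have ht₀' := ht'
    rw [D.theta_eq] at ht₀ ht₀'
    obtain ⟨o, ho, hlo⟩ := ht₀
    obtain ⟨o', ho', hlo'⟩ := ht₀'
    have hio : IsOfFinAddOrder (ρ o - o) := (isOfFinAddOrder_iota_sub_iff_of_theta ρ hl hlo).mp hinv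
    have hio' : IsOfFinAddOrder (ρ o' - o') :=
      (isOfFinAddOrder_iota_sub_iff_of_theta ρ hl hlo').mp hinv'
    obtain ⟨c, hc, rfl⟩ := hmem o ho hio
    obtain ⟨c', hc', rfl⟩ := hmem o' ho' hio'
    have h1 : (2 * S.l) • ((t' + (τ 0 + c')) - (t + (τ 0 + c))) = 0 := by
      rw [smul_sub, mul_nsmul', hlo', mul_nsmul', hlo, sub_self]
    have h2 : (2 * S.l) • (c' - c) = 0 := by
      rw [smul_sub, mul_nsmul, hc', mul_nsmul, hc, sub_self]
    have hsplit : t' - t = ((t' + (τ 0 + c')) - (t + (τ 0 + c))) - (c' - c) := by abel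
    rw [hsplit, smul_sub, h1, h2, sub_self]

end Prop22ii

end Literature.IUT.HodgeArakelov
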